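import Summits.QuantumFields.YangMills.Theses.MirrorModularBoosts
import Summits.QuantumFields.YangMills.Theses.ScalingWindowSplit
import Summits.QuantumFields.YangMills.Theorems.MirrorModularBoostsHypercubicLimitOfWeakCoupling
import Summits.QuantumFields.YangMills.Theorems.CoincidenceRotationBootstrapHypercubicLimitOneFieldWeak
import Summits.QuantumFields.YangMills.Theorems.GronwallGapContinuumFromLatticeGapOneFieldLocal
import HarnessLib

/-!
# `MirrorModularBoosts.HypercubicLimit` (item stmt-QuantumFields-8646) from the REPAIRED lattice triple W₁ᴸ / U_RS / W₂ᴳ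

Crux stmt-QuantumFields-8646 (`MirrorModularBoosts.HypercubicLimit`, the pre-re-type existence leg) follows from its weak-coupling
twin `CoincidenceRotationBootstrap.HypercubicLimit` (stmt-QuantumFields-16154) by `hypercubicLimit_of_coincidenceRotationBootstrap`
(p147954).  The r1 redirect strategist of this crux (`Cruxes/HypercubicLimit/STRATEGY-CENSUS.md`, `SPLIT-r1.md`) prepared the split of
the twin onto the REPAIRED lattice triple

* W₁ᴸ `GapAtCorrelationLengthLocal` — the repair of `ScalingWindowSplit.GapAtCorrelationLength` (stmt-QuantumFields-18927, refuted
  modulo `PersistentSlabCorrelation` because its RP-spectral conjunct ranges over the spatially GLOBAL slab class,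
  `Theorems/GapAtCorrelationLength/Negative/GapAtCorrelationLengthFalseOfPersistentSlabCorrelation.lean`): the same statement with the
  RP-spectral conjunct over the LOCAL slab class (`|x_i| ≤ R`, `2(R+1) ≤ S₀`) — exactly the hypothesis of the landed local seam
  `ContinuumFromLatticeGap.oneField_of_latticeInequalities_local`;
* U_RS `SelfNormalisedMomentBoundsRS` — the repair of `ScalingWindowSplit.SelfNormalisedMomentBoundsR` (stmt-QuantumFields-18014, held:
  masked `U(1) × SU(2)` sector): `IsCompactSimpleLieGroup G →` inserted;
* W₂ᴳ `ScalingWindowSplit.SelfNormalisedSkewnessGapped` (stmt-QuantumFields-18170) unchanged.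

This file makes the corresponding glue TREE theorems, for item 8646 by name (the registered skeleton of 8646, line
`conditional-mean-telescoping`, reshape 7, has exactly these three statements as its stubs): `weakCouplingHypercubicLimit_of_repairedTriple`
(W₁ᴸ → U_RS → W₂ᴳ → the twin 16154; body = the strategist's certified `SplitGlue_r1.lean :: HypercubicLimit_of_subs`),
`hypercubicLimit_of_repairedTriple_8646` (… → item 8646), and the two weakenings `gapAtCorrelationLengthLocal_of_gapAtCorrelationLength`
(W₁ → W₁ᴸ) and `selfNormalisedMomentBoundsRS_of_selfNormalisedMomentBoundsR` (U_R → U_RS), so that the CURRENT `ScalingWindowSplit` items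
still close 8646 through the repaired pieces (`hypercubicLimit_of_scalingWindowSplit_viaRepaired`, agreeing with p167242).  The two repaired
statements are written out (texts of `SPLIT-r1.md` children.json = `Cruxes/GapAtCorrelationLength/RestateKit.lean ::
GapAtCorrelationLengthLocal` and `Cruxes/SelfNormalisedMomentBoundsR/MaskedSectorObstruction.lean :: Strategist.SelfNormalisedMomentBoundsRS`,
which are crux work files and cannot be imported under `Theorems/`) VERBATIM up to one cosmetic zeta-reduction: the leading
`let E := EuclideanSpace ℝ (Fin 4);` of the filed texts is substituted in (a top-level `let` in a theorem binder leaks its variable in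
Lean; the substituted statements are `Iff.rfl` to the filed ones — checked in the registered skeleton); no definition is introduced.  Pure composition of landed theorems.
-/

noncomputable section

open scoped SchwartzMap
open MeasureTheory Filter Topology
open Literature.MathematicalPhysics.AQFT Literature.MathematicalPhysics.QuantumLattice
open Literature.MathematicalPhysics.QuantumFieldTheory

namespace Summit.QuantumFields.YangMills.Theorems.HypercubicLimit

/-- **W₁ → W₁ᴸ**: the typed `ScalingWindowSplit.GapAtCorrelationLength` implies its LOCAL repair (the local slab class is a subclass of
the slab class, so the RP-spectral conjunct specialises; every other conjunct is untouched).  Conclusion = `SPLIT-r1.md` child 1 (`let E` substituted).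
-- adapted from Cruxes/GapAtCorrelationLength/RestateKit.lean (gapAtCorrelationLengthLocal_of_gapAtCorrelationLength) [folklore] -/
theorem gapAtCorrelationLengthLocal_of_gapAtCorrelationLength
    (h : Summit.QuantumFields.YangMills.Theses.ScalingWindowSplit.GapAtCorrelationLength) :
    ∀ (G : Type) [Group G] [TopologicalSpace G] [IsTopologicalGroup G] [CompactSpace G], IsCompactSimpleLieGroup G → letI : MeasurableSpace G := borel G; haveI : BorelSpace G := ⟨rfl⟩; ∃ (r : LatticeRep G) (sch : SpeciesScheme (YMSpecies G)) (u : SchwartzMap (EuclideanSpace ℝ (Fin 4)) ℝ) (p : ℕ) (M Δ C : ℝ), let bare : SpeciesScheme (YMSpecies G) := { sch with c := fun _ _ => 1, m := fun _ _ => 0 }; let T : SchwartzMap (EuclideanSpace ℝ (Fin 4)) ℝ → ℕ → ℝ := fun w k => latticeSchwinger r.ρ bare (fun s => s.F) k (1 + 1) (fun _ => r.curvature) ![w, thetaTest 4 w] - latticeSchwinger r.ρ bare (fun s => s.F) k 1 (fun _ => r.curvature) ![w] * latticeSchwinger r.ρ bare (fun s => s.F) k 1 (fun _ => r.curvature) ![thetaTest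 4 w]; sch.HasWeakCouplingLimit ∧ (∃ N : ℕ, 1 ≤ N ∧ ∀ᶠ k in Filter.atTop, (sch.a k)⁻¹ ≤ (sch.a k * (sch.L k : ℝ)) ^ N) ∧ 0 < Δ ∧ HasLatticeMassGap r sch Δ ∧ (∀ᶠ k in Filter.atTop, ∀ (S₀ T₀ n R : ℕ), sch.L k ≤ S₀ → 2 * (T₀ + n + 1) ≤ S₀ → 2 * (R + 1) ≤ S₀ → ∀ (Y : LGConfig 4 G → ℝ) (B : ℝ), Measurable Y → (∀ U, |Y U| ≤ B) → DependsOn Y {e : Literature.MathematicalPhysics.QuantumLattice.ZdEdge 4 | (1 ≤ e.1 0 ∧ e.1 0 + (if e.2 = 0 then 1 else 0) ≤ T₀) ∧ ∀ i : Fin 4, i ≠ 0 → |e.1 i| ≤ R} → |(∫ U, Y (torusLift (2 * S₀ + 1) (GaugeConfig.timeReflect U)) * Y (configShift (-Pi.single 0 (n : ℤ)) (torusLift (2 * S₀ + 1) U)) ∂(wilsonMeasure r.ρ (sch.β k) : Measure (GaugeConfig 4 (2 * S₀ + 1) G))) - (∫ U, Y (torusLift (2 * S₀ + 1) U) ∂(wilsonMeasure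 r.ρ (sch.β k) : Measure (GaugeConfig 4 (2 * S₀ + 1) G))) ^ 2| ≤ Real.exp (-(Δ * sch.a k * n)) * ((∫ U, Y (torusLift (2 * S₀ + 1) (GaugeConfig.timeReflect U)) * Y (torusLift (2 * S₀ + 1) U) ∂(wilsonMeasure r.ρ (sch.β k) : Measure (GaugeConfig 4 (2 * S₀ + 1) G))) - (∫ U, Y (torusLift (2 * S₀ + 1) U) ∂(wilsonMeasure r.ρ (sch.β k) : Measure (GaugeConfig 4 (2 * S₀ + 1) G))) ^ 2) + C * B ^ 2 * Real.exp (-(Δ * sch.a k * S₀))) ∧ tsupport u ⊆ {y : (EuclideanSpace ℝ (Fin 4)) | y 0 < 0} ∧ ∀ᶠ k in Filter.atTop, (sch.a k) ^ p ≤ T u k ∧ T u k ≤ M * T (timeShiftTest 4 (-1) u) k := by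
  intro G _ _ _ _ hG
  letI : MeasurableSpace G := borel G
  haveI : BorelSpace G := ⟨rfl⟩
  obtain ⟨r, sch, u, p, M, Δ, C, hw, hpv, hΔ, hgap, hrp, hu, hfw⟩ := h G hG
  refine ⟨r, sch, u, p, M, Δ, C, hw, hpv, hΔ, hgap, ?_, hu, hfw⟩
  filter_upwards [hrp] with k hk S₀ T₀ n R hL h2 _hR Y B hYm hYb hYdep
  exact hk S₀ T₀ n hL h2 Y B hYm hYb (hYdep.mono fun e he => he.1)

/-- **U_R → U_RS**: the typed `ScalingWindowSplit.SelfNormalisedMomentBoundsR` (all compact `G`) implies its repair restricted to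
compact SIMPLE `G`.  Conclusion = `SPLIT-r1.md` child 2 (`let E` substituted).
-- adapted from Cruxes/SelfNormalisedMomentBoundsR/MaskedSectorObstruction.lean (selfNormalisedMomentBoundsRS_of_R) [folklore] -/
theorem selfNormalisedMomentBoundsRS_of_selfNormalisedMomentBoundsR
    (h : Summit.QuantumFields.YangMills.Theses.ScalingWindowSplit.SelfNormalisedMomentBoundsR) :
    ∀ (G : Type) [Group G] [TopologicalSpace G] [IsTopologicalGroup G] [CompactSpace G] [MeasurableSpace G] [BorelSpace G], IsCompactSimpleLieGroup G → ∀ (r : LatticeRep G) (sch : SpeciesScheme (YMSpecies G)) (u : SchwartzMap (EuclideanSpace ℝ (Fin 4)) ℝ) (p : ℕ) (M : ℝ), let bare : SpeciesScheme (YMSpecies G) := { sch with c := fun _ _ => 1, m := fun _ _ => 0 }; let T : SchwartzMap (EuclideanSpace ℝ (Fin 4)) ℝ → ℕ → ℝ := fun w k => latticeSchwinger r.ρ bare (fun s => s.F) k (1 + 1) (fun _ => r.curvature) ![w, thetaTest 4 w] - latticeSchwinger r.ρ bare (fun s => s.F) k 1 (fun _ => r.curvature) ![w] * latticeSchwinger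 r.ρ bare (fun s => s.F) k 1 (fun _ => r.curvature) ![thetaTest 4 w]; let canon : SpeciesScheme (YMSpecies G) := { sch with c := fun _ k => (Real.sqrt (T u k))⁻¹, m := fun _ k => ∫ U, r.curvature.F (torusLift (sch.side k) U) ∂(wilsonMeasure r.ρ (sch.β k)) }; sch.HasWeakCouplingLimit → (∃ N : ℕ, 1 ≤ N ∧ ∀ᶠ k in Filter.atTop, (sch.a k)⁻¹ ≤ (sch.a k * (sch.L k : ℝ)) ^ N) → tsupport u ⊆ {y : (EuclideanSpace ℝ (Fin 4)) | y 0 < 0} → (∀ᶠ k in Filter.atTop, (sch.a k) ^ p ≤ T u k ∧ T u k ≤ M * T (timeShiftTest 4 (-1) u) k) → ∃ (s : ℕ) (C₀ C₁ : ℝ), ∀ (n : ℕ) (F : Fin n → {q : Fin 4 × Fin 4 // q.1 < q.2} → SchwartzMap (EuclideanSpace ℝ (Fin 4)) ℝ), (∀ i, ∑ q, schwartzNorm s (ofRealTest (F i q)) ≤ 1) → (∀ i j, i ≠ j → ∀ q q', Disjoint (tsupport (F i q)) (tsupport (F j q'))) → ∀ k : ℕ, |∫ U, ∏ i, ∑ q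 : {q : Fin 4 × Fin 4 // q.1 < q.2}, smearedLatticeField (plaquetteObs r.ρ 0 q.1.1 q.1.2) (Literature.Probability.LatticeModels.box 4 (canon.L k)) (canon.a k) (canon.c r.curvature k) (canon.m r.curvature k / 6) (F i q) (torusLift (canon.side k) U) ∂(wilsonMeasure r.ρ (canon.β k) : Measure (GaugeConfig 4 (canon.side k) G))| ≤ C₀ * C₁ ^ n * n.factorial :=
  fun G _ _ _ _ _ _ _hG r sch u p M => h G r sch u p M

/-- **THE GLUE of the repaired split, twin form**: W₁ᴸ → U_RS → W₂ᴳ → `CoincidenceRotationBootstrap.HypercubicLimit`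
(stmt-QuantumFields-16154).  Per compact simple `G` take W₁ᴸ's witness `(r, sch, u, p, M, Δ, C)` and apply the landed LOCAL seam
`ContinuumFromLatticeGap.oneField_of_latticeInequalities_local`, feeding U_RS the consumer's own simplicity hypothesis; then
`OneFieldWeak.hypercubicLimit_iff_oneFieldWeak`.  Body = the r1 strategist's certified `SplitGlue_r1.lean :: HypercubicLimit_of_subs`.
[cite: GlimmJaffe1987, §6.1 and §19.1] -/
theorem weakCouplingHypercubicLimit_of_repairedTriple :
    (∀ (G : Type) [Group G] [TopologicalSpace G] [IsTopologicalGroup G] [CompactSpace G], IsCompactSimpleLieGroup G → letI : MeasurableSpace G := borel G; haveI : BorelSpace G := ⟨rfl⟩; ∃ (r : LatticeRep G) (sch : SpeciesScheme (YMSpecies G)) (u : SchwartzMap (EuclideanSpace ℝ (Fin 4)) ℝ) (p : ℕ) (M Δ C : ℝ), let bare : SpeciesScheme (YMSpecies G) := { sch with c := fun _ _ => 1, m := fun _ _ => 0 }; let T : SchwartzMap (EuclideanSpace ℝ (Fin 4)) ℝ → ℕ → ℝ := fun w k => latticeSchwinger r.ρ bare (fun s => s.F) k (1 + 1) (fun _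 => r.curvature) ![w, thetaTest 4 w] - latticeSchwinger r.ρ bare (fun s => s.F) k 1 (fun _ => r.curvature) ![w] * latticeSchwinger r.ρ bare (fun s => s.F) k 1 (fun _ => r.curvature) ![thetaTest 4 w]; sch.HasWeakCouplingLimit ∧ (∃ N : ℕ, 1 ≤ N ∧ ∀ᶠ k in Filter.atTop, (sch.a k)⁻¹ ≤ (sch.a k * (sch.L k : ℝ)) ^ N) ∧ 0 < Δ ∧ HasLatticeMassGap r sch Δ ∧ (∀ᶠ k in Filter.atTop, ∀ (S₀ T₀ n R : ℕ), sch.L k ≤ S₀ → 2 * (T₀ + n + 1) ≤ S₀ → 2 * (R + 1) ≤ S₀ → ∀ (Y : LGConfig 4 G → ℝ) (B : ℝ), Measurable Y → (∀ U, |Y U| ≤ B) → DependsOn Y {e : Literature.MathematicalPhysics.QuantumLattice.ZdEdge 4 | (1 ≤ e.1 0 ∧ e.1 0 + (if e.2 = 0 then 1 else 0) ≤ T₀) ∧ ∀ i : Fin 4, i ≠ 0 → |e.1 i| ≤ R} → |(∫ U, Y (torusLift (2 * S₀ + 1) (GaugeConfig.timeReflect U)) * Y (configShift (-Pi.single 0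 (n : ℤ)) (torusLift (2 * S₀ + 1) U)) ∂(wilsonMeasure r.ρ (sch.β k) : Measure (GaugeConfig 4 (2 * S₀ + 1) G))) - (∫ U, Y (torusLift (2 * S₀ + 1) U) ∂(wilsonMeasure r.ρ (sch.β k) : Measure (GaugeConfig 4 (2 * S₀ + 1) G))) ^ 2| ≤ Real.exp (-(Δ * sch.a k * n)) * ((∫ U, Y (torusLift (2 * S₀ + 1) (GaugeConfig.timeReflect U)) * Y (torusLift (2 * S₀ + 1) U) ∂(wilsonMeasure r.ρ (sch.β k) : Measure (GaugeConfig 4 (2 * S₀ + 1) G))) - (∫ U, Y (torusLift (2 * S₀ + 1) U) ∂(wilsonMeasure r.ρ (sch.β k) : Measure (GaugeConfig 4 (2 * S₀ + 1) G))) ^ 2) + C * B ^ 2 * Real.exp (-(Δ * sch.a k * S₀))) ∧ tsupport u ⊆ {y : (EuclideanSpace ℝ (Fin 4)) | y 0 < 0} ∧ ∀ᶠ k in Filter.atTop, (sch.a k) ^ p ≤ T u k ∧ T u k ≤ M * T (timeShiftTest 4 (-1) u) k) →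
    (∀ (G : Type) [Group G] [TopologicalSpace G] [IsTopologicalGroup G] [CompactSpace G] [MeasurableSpace G] [BorelSpace G], IsCompactSimpleLieGroup G → ∀ (r : LatticeRep G) (sch : SpeciesScheme (YMSpecies G)) (u : SchwartzMap (EuclideanSpace ℝ (Fin 4)) ℝ) (p : ℕ) (M : ℝ), let bare : SpeciesScheme (YMSpecies G) := { sch with c := fun _ _ => 1, m := fun _ _ => 0 }; let T : SchwartzMap (EuclideanSpace ℝ (Fin 4)) ℝ → ℕ → ℝ := fun w k => latticeSchwinger r.ρ bare (fun s => s.F) k (1 + 1) (fun _ => r.curvature) ![w, thetaTest 4 w] - latticeSchwinger r.ρ bare (fun s => s.F) k 1 (fun _ => r.curvature) ![w] * latticeSchwinger r.ρ bare (fun s => s.F) k 1 (fun _ => r.curvature) ![thetaTest 4 w]; let canon : SpeciesScheme (YMSpecies G) := { sch with c := fun _ k => (Real.sqrt (T u k))⁻¹, m := fun _ k => ∫ U, r.curvature.F (torusLift (sch.side k) U) ∂(wilsonMeasure r.ρ (sch.β k)) }; sch.HasWeakCouplingLimit → (∃ N : ℕ, 1 ≤ N ∧ ∀ᶠ k in Filter.atTop,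 (sch.a k)⁻¹ ≤ (sch.a k * (sch.L k : ℝ)) ^ N) → tsupport u ⊆ {y : (EuclideanSpace ℝ (Fin 4)) | y 0 < 0} → (∀ᶠ k in Filter.atTop, (sch.a k) ^ p ≤ T u k ∧ T u k ≤ M * T (timeShiftTest 4 (-1) u) k) → ∃ (s : ℕ) (C₀ C₁ : ℝ), ∀ (n : ℕ) (F : Fin n → {q : Fin 4 × Fin 4 // q.1 < q.2} → SchwartzMap (EuclideanSpace ℝ (Fin 4)) ℝ), (∀ i, ∑ q, schwartzNorm s (ofRealTest (F i q)) ≤ 1) → (∀ i j, i ≠ j → ∀ q q', Disjoint (tsupport (F i q)) (tsupport (F j q'))) → ∀ k : ℕ, |∫ U, ∏ i, ∑ q : {q : Fin 4 × Fin 4 // q.1 < q.2}, smearedLatticeField (plaquetteObs r.ρ 0 q.1.1 q.1.2) (Literature.Probability.LatticeModels.box 4 (canon.L k)) (canon.a k) (canon.c r.curvature k) (canon.m r.curvature k / 6) (F i q) (torusLift (canon.side k) U) ∂(wilsonMeasure r.ρ (canon.β k) : Measure (GaugeConfig 4 (canon.side k) G))| ≤ C₀ * C₁ ^ n * n.factorial)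 →
    Summit.QuantumFields.YangMills.Theses.ScalingWindowSplit.SelfNormalisedSkewnessGapped →
    Summit.QuantumFields.YangMills.Theses.CoincidenceRotationBootstrap.HypercubicLimit := by
  intro hW hU hS
  refine OneFieldWeak.hypercubicLimit_iff_oneFieldWeak.mpr fun G _ _ _ _ hG => ?_
  letI : MeasurableSpace G := borel G
  haveI : BorelSpace G := ⟨rfl⟩
  obtain ⟨r, sch, u, p, M, Δ, C, hw, hpv, hΔ, hgap, hrp, hu, hfw⟩ := hW G hG
  obtain ⟨sch', S₁, hw', h₁⟩ :=
    Summit.QuantumFields.YangMills.Theorems.ContinuumFromLatticeGap.oneField_of_latticeInequalities_local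
      r sch u p M Δ C hw hpv hΔ hgap hrp hu hfw
      (hU G hG r sch u p M hw hpv hu hfw) (hS G r sch u p M Δ hw hΔ hgap hpv hu hfw)
  exact ⟨r, sch', S₁, hw', h₁⟩

/-- **Item 8646 from the repaired triple**: W₁ᴸ → U_RS → W₂ᴳ → `MirrorModularBoosts.HypercubicLimit` — the twin glue followed by
forgetting `sch.HasWeakCouplingLimit` (`hypercubicLimit_of_coincidenceRotationBootstrap`, p147954).  This is the composition
`HypercubicLimit_proof` of the registered skeleton of stmt-QuantumFields-8646 (line `conditional-mean-telescoping`, reshape 7) with its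
three stubs as hypotheses. [folklore] -/
theorem hypercubicLimit_of_repairedTriple_8646 :
    (∀ (G : Type) [Group G] [TopologicalSpace G] [IsTopologicalGroup G] [CompactSpace G], IsCompactSimpleLieGroup G → letI : MeasurableSpace G := borel G; haveI : BorelSpace G := ⟨rfl⟩; ∃ (r : LatticeRep G) (sch : SpeciesScheme (YMSpecies G)) (u : SchwartzMap (EuclideanSpace ℝ (Fin 4)) ℝ) (p : ℕ) (M Δ C : ℝ), let bare : SpeciesScheme (YMSpecies G) := { sch with c := fun _ _ => 1, m := fun _ _ => 0 }; let T : SchwartzMap (EuclideanSpace ℝ (Fin 4)) ℝ → ℕ → ℝ := fun w k => latticeSchwinger r.ρ bare (fun s => s.F) k (1 + 1) (fun _ => r.curvature) ![w, thetaTest 4 w] - latticeSchwinger r.ρ bare (fun s => s.F) k 1 (fun _ => r.curvature) ![w] * latticeSchwinger r.ρ bare (fun s => s.F) k 1 (fun _ => r.curvature) ![thetaTest 4 w]; sch.HasWeakCouplingLimit ∧ (∃ N : ℕ, 1 ≤ N ∧ ∀ᶠ k in Filter.atTop, (sch.a k)⁻¹ ≤ (sch.a k * (sch.L k : ℝ))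 ^ N) ∧ 0 < Δ ∧ HasLatticeMassGap r sch Δ ∧ (∀ᶠ k in Filter.atTop, ∀ (S₀ T₀ n R : ℕ), sch.L k ≤ S₀ → 2 * (T₀ + n + 1) ≤ S₀ → 2 * (R + 1) ≤ S₀ → ∀ (Y : LGConfig 4 G → ℝ) (B : ℝ), Measurable Y → (∀ U, |Y U| ≤ B) → DependsOn Y {e : Literature.MathematicalPhysics.QuantumLattice.ZdEdge 4 | (1 ≤ e.1 0 ∧ e.1 0 + (if e.2 = 0 then 1 else 0) ≤ T₀) ∧ ∀ i : Fin 4, i ≠ 0 → |e.1 i| ≤ R} → |(∫ U, Y (torusLift (2 * S₀ + 1) (GaugeConfig.timeReflect U)) * Y (configShift (-Pi.single 0 (n : ℤ)) (torusLift (2 * S₀ + 1) U)) ∂(wilsonMeasure r.ρ (sch.β k) : Measure (GaugeConfig 4 (2 * S₀ + 1) G))) - (∫ U, Y (torusLift (2 * S₀ + 1) U) ∂(wilsonMeasure r.ρ (sch.β k) : Measure (GaugeConfig 4 (2 * S₀ + 1) G))) ^ 2| ≤ Real.exp (-(Δ * sch.a k * n)) * ((∫ U, Y (torusLift (2 * S₀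 + 1) (GaugeConfig.timeReflect U)) * Y (torusLift (2 * S₀ + 1) U) ∂(wilsonMeasure r.ρ (sch.β k) : Measure (GaugeConfig 4 (2 * S₀ + 1) G))) - (∫ U, Y (torusLift (2 * S₀ + 1) U) ∂(wilsonMeasure r.ρ (sch.β k) : Measure (GaugeConfig 4 (2 * S₀ + 1) G))) ^ 2) + C * B ^ 2 * Real.exp (-(Δ * sch.a k * S₀))) ∧ tsupport u ⊆ {y : (EuclideanSpace ℝ (Fin 4)) | y 0 < 0} ∧ ∀ᶠ k in Filter.atTop, (sch.a k) ^ p ≤ T u k ∧ T u k ≤ M * T (timeShiftTest 4 (-1) u) k) →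
    (∀ (G : Type) [Group G] [TopologicalSpace G] [IsTopologicalGroup G] [CompactSpace G] [MeasurableSpace G] [BorelSpace G], IsCompactSimpleLieGroup G → ∀ (r : LatticeRep G) (sch : SpeciesScheme (YMSpecies G)) (u : SchwartzMap (EuclideanSpace ℝ (Fin 4)) ℝ) (p : ℕ) (M : ℝ), let bare : SpeciesScheme (YMSpecies G) := { sch with c := fun _ _ => 1, m := fun _ _ => 0 }; let T : SchwartzMap (EuclideanSpace ℝ (Fin 4)) ℝ → ℕ → ℝ := fun w k => latticeSchwinger r.ρ bare (fun s => s.F) k (1 + 1) (fun _ => r.curvature) ![w, thetaTest 4 w] - latticeSchwinger r.ρ bare (fun s => s.F) k 1 (fun _ => r.curvature) ![w] * latticeSchwinger r.ρ bare (fun s => s.F) k 1 (fun _ => r.curvature) ![thetaTest 4 w]; let canon : SpeciesScheme (YMSpecies G) := { sch with c := fun _ k => (Real.sqrt (T u k))⁻¹, m := fun _ k => ∫ U, r.curvature.F (torusLift (sch.side k) U) ∂(wilsonMeasure r.ρ (sch.β k)) }; sch.HasWeakCouplingLimit → (∃ N : ℕ, 1 ≤ N ∧ ∀ᶠ k in Filter.atTop,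 (sch.a k)⁻¹ ≤ (sch.a k * (sch.L k : ℝ)) ^ N) → tsupport u ⊆ {y : (EuclideanSpace ℝ (Fin 4)) | y 0 < 0} → (∀ᶠ k in Filter.atTop, (sch.a k) ^ p ≤ T u k ∧ T u k ≤ M * T (timeShiftTest 4 (-1) u) k) → ∃ (s : ℕ) (C₀ C₁ : ℝ), ∀ (n : ℕ) (F : Fin n → {q : Fin 4 × Fin 4 // q.1 < q.2} → SchwartzMap (EuclideanSpace ℝ (Fin 4)) ℝ), (∀ i, ∑ q, schwartzNorm s (ofRealTest (F i q)) ≤ 1) → (∀ i j, i ≠ j → ∀ q q', Disjoint (tsupport (F i q)) (tsupport (F j q'))) → ∀ k : ℕ, |∫ U, ∏ i, ∑ q : {q : Fin 4 × Fin 4 // q.1 < q.2}, smearedLatticeField (plaquetteObs r.ρ 0 q.1.1 q.1.2) (Literature.Probability.LatticeModels.box 4 (canon.L k)) (canon.a k) (canon.c r.curvature k) (canon.m r.curvature k / 6) (F i q) (torusLift (canon.side k) U) ∂(wilsonMeasure r.ρ (canon.β k) : Measure (GaugeConfig 4 (canon.side k) G))| ≤ C₀ * C₁ ^ n * n.factorial)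 →
    Summit.QuantumFields.YangMills.Theses.ScalingWindowSplit.SelfNormalisedSkewnessGapped →
    Summit.QuantumFields.YangMills.Theses.MirrorModularBoosts.HypercubicLimit :=
  fun hW hU hS => hypercubicLimit_of_coincidenceRotationBootstrap (weakCouplingHypercubicLimit_of_repairedTriple hW hU hS)

/-- **The CURRENT `ScalingWindowSplit` triple closes item 8646 through the repaired pieces** (so nothing landed `--supports`
stmt-18927 / stmt-18014 / stmt-18170 is lost by the repair; agrees with `hypercubicLimit_of_scalingWindowSplit`, p167242). [folklore] -/
theorem hypercubicLimit_of_scalingWindowSplit_viaRepaired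
    (hW : Summit.QuantumFields.YangMills.Theses.ScalingWindowSplit.GapAtCorrelationLength)
    (hU : Summit.QuantumFields.YangMills.Theses.ScalingWindowSplit.SelfNormalisedMomentBoundsR)
    (hS : Summit.QuantumFields.YangMills.Theses.ScalingWindowSplit.SelfNormalisedSkewnessGapped) :
    Summit.QuantumFields.YangMills.Theses.MirrorModularBoosts.HypercubicLimit :=
  hypercubicLimit_of_repairedTriple_8646 (gapAtCorrelationLengthLocal_of_gapAtCorrelationLength hW)
    (selfNormalisedMomentBoundsRS_of_selfNormalisedMomentBoundsR hU) hS

end Summit.QuantumFields.YangMills.Theorems.HypercubicLimit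

end
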